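import Mathlib
import Literature.MathematicalPhysics.QuantumFieldTheory.Balaban1983to89.Setup

/-!
# `Balaban1983to89.B14Sect3Decomp` — T. Bałaban, *Convergent renormalization expansions for lattice gauge theories*,
# Commun. Math. Phys. **119** (1988) 243–285 [Balaban1988Convergent]: the displays (3.2), (3.3), (3.4) p. 265 and
# (3.10), (3.11) p. 266 of the k+1-st step (decompositions of unity in the background and approximate-fluctuation
# fields, the localized k-th configuration `V^{(k)}_{□′}`, the variational field `V^{(k)}` and the fluctuation field
# `V′_k`), TYPED over `Setup`, with (3.2)/(3.3) PROVED

statement-level skeleton of published theorems with citation tags; proofs where landed; nothing here is a claim about the Yang–Mills mass gap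

PDF held: `paper:balaban1988-cmp119-convergent-renormalization` (journal page = PDF page + 242); displays read on the x2
renders `…-p023-x2.png` (p. 265) and `…-p024-x2.png` (p. 266) of
`run/shared/lean/pub/pub-balaban/b2b-balaban-ref1/pages/1988-cmp119-convergent-renormalization/`.

CITATION HEADER (lean-in-tree rule).  WHAT IS REPRODUCED, verbatim.
* p. 265 [PDF 23]: *"1 = Σ_{P_{k+1}} Π_{□′⊂Pᶜ_{k+1}} χ({sup_{p⊂□′^∼}|U_{k+1,□′}(∂p) − 1| < ε_{k+1}(L⁻¹η)²})
  · Π_{□′⊂P_{k+1}} χ({sup_{p⊂□′^∼}|U_{k+1,□′}(∂p) − 1| ≧ ε_{k+1}(L⁻¹η)²}) = Σ_{P_{k+1}} χ_{k+1}(Pᶜ_{k+1})χᶜ_{k+1}(P_{k+1}), (3.2)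
  where the summation is over domains P_{k+1} ⊂ (Z′^{∼4}_k)ᶜ, which are unions of L²M₂R_{k+1}-cubes."*;
  *"1 = Σ_{Q_{k+1}} Π_{□′⊂Qᶜ_{k+1}} χ({sup_{b∈(□′^{∼2})^{(k)*}}|V_k(b)(V^{(k)}_{□′}(b))⁻¹ − 1| < 2δ_k}) · Π_{□′⊂Q_{k+1}} χ({…
  ≧ 2δ_k}) = Σ_{Q_{k+1}} χ′_k(Qᶜ_{k+1})χ′ᶜ_k(Q_{k+1}). (3.3)  The summation is over subdomains Q_{k+1} ⊂ (B^{k+1}(P¹_{k+1}))^{∼−1},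
  which are unions of L²M₂R_{k+1}-cubes, and the complement is relative to the domain (B^{k+1}(P¹_{k+1}))^{∼−1}. The
  configuration V^{(k)}_{□′} is defined on (□′^∼)^{(k)} by V^{(k)}_{□′} = M^k(U_{k+1,□′}), (3.4) and δ_k = g_kA₁/A₀p₀(g_k)."* —
  SKELETON rows **B14.Eq3.2–3.4** (the combined Phase-1 row) .
* p. 266 [PDF 24]: *"Define the field V^{(k)} on Ω^{(k)}_{k+1} as the minimum of the functional
  V_k|_{Ω^{(k)}_{k+1}} → A(U_k) for V_k : V̄_k = V_{k+1} on Γ_{k+1} = Ω^{(k+1)}_{k+1}, V_k(y, x) = 1 for y ∈ Γ_{k+1}, x ∈ B(y).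
  (3.10)  This minimum is given by V^{(k)} = M^k(U_{k+1}), where the minimal configuration U_{k+1} is determined by the
  sequence of domains {Ω_{k+1}, Ω_k, …}, and the corresponding sequence of fields {V_{k+1}|_{Γ_{k+1}}, V_k|_{Γ_k}, …}. The
  fluctuation field V′_k is defined now by V′_k = V_k(V^{(k)})⁻¹ on B(Γ_{k+1}). (3.11)"* — SKELETON row **B14.Eq3.10–3.11**.

THE TYPED READING.  CONCRETE (`Setup`): the lattices `Site P j`, the fields `V_k : GaugeField P k G`,
`V_{k+1} : GaugeField P (k+1) G`, the fine configurations `GaugeField P 0 G`, the k-fold average `M^k` (`Averaging.iter`),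
the blocks and averaged contour variables (`blockOf`, `emb`, `ContourData.holTo`), the small-plaquette function `Setup.chiSmall`
and the distance `dist1 = |· − 1|`.  DATA (`Sect3Data`): the L²M₂R_{k+1}-cubes `□′` (index type `Cube1`) with the
plaquette sets `{p ⊂ □′^∼}` (on `T_η`) and the bond sets `(□′^{∼2})^{(k)*}` (on `T^{(k)}`), the set operation
`P_{k+1} ↦ (B^{k+1}(P¹_{k+1}))^{∼−1}` as a family of cubes (`inB`), and the localized background `U_{k+1,□′}(V_{k+1})` of
(2.16) (`UkLoc`; row B14.Eq2.16).  Then χ_{k+1}, χᶜ_{k+1} (3.2), `V^{(k)}_{□′}` (3.4, CONCRETE: `Averaging.iter av k ∘ UkLoc`),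
χ′_k, χ′ᶜ_k (3.3), the constraint set and minimality predicate of (3.10) (CONCRETE over `Averaging.avg` and `holTo`), and
`V′_k` (3.11) are DEFINITIONS; (3.2) and (3.3) are PROVED (`Π(χ + χᶜ) = 1`, `Finset.prod_add`); the sentence *"This
minimum is given by V^{(k)} = M^k(U_{k+1})"* is typed as the `Prop` `Claim310` (a claim by reference to the variational
results of [15], NOT proved).  The thresholds: `ε_{k+1}(L⁻¹η)²` with `η = L^{−k}` is `ε_{k+1} · (P.eta (k+1))²`;
`2δ_k` is the parameter `twoδ`.  (3.5) (the domain Ω_{k+1}) is set geometry of `…B14DomainGeom` and is not re-typed.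
Mega-formalization `lit-balaban`, unit `lit-balaban-r11` gen 2 (completeness typing of the B14 §3 displays listed as
"absent sub-displays" in ROWS-B14 v1.6), HOME `run/shared/lean/pub/lit-balaban/`.

## References
* [Balaban1988Convergent] T. Bałaban, Commun. Math. Phys. 119 (1988) 243–285, (3.2)–(3.4) p. 265, (3.10)–(3.11) p. 266.
-/

noncomputable section

namespace Literature.MathematicalPhysics.QuantumFieldTheory.Balaban1983to89.B14.Sect3Decomp

open Literature.MathematicalPhysics.QuantumFieldTheory.Balaban1983to89
open scoped BigOperators

/-! ## §0. Data -/

/-- The objects of p. 265 on top of `Setup` at step `k+1`, as DATA: the L²M₂R_{k+1}-cubes `□′` of `(Z′^{∼4}_k)ᶜ`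
(`Cube1`), their plaquette sets `{p ⊂ □′^∼}` on `T_η` (`plaqT`), their starred bond sets `(□′^{∼2})^{(k)*}` on `T^{(k)}`
(`bondsStar`), the family of cubes of `(B^{k+1}(P¹_{k+1}))^{∼−1}` determined by `P_{k+1}` (`inB`), and the localized
background `U_{k+1,□′}(V_{k+1})` of (2.16) (`UkLoc`). [cite: Balaban1988Convergent, (3.2)–(3.4) p.265] -/
structure Sect3Data (P : Params) (G : Type*) [GaugeGroup G] (k : ℕ) where
  Cube1 : Type
  [fin1 : Fintype Cube1]
  [dec1 : DecidableEq Cube1]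
  plaqT : Cube1 → Set (Plaq P 0)
  bondsStar : Cube1 → Finset (PBond P k)
  inB : Finset Cube1 → Finset Cube1
  UkLoc : Cube1 → GaugeField P (k+1) G → GaugeField P 0 G

variable {P : Params} {G : Type*} [GaugeGroup G] {k : ℕ}

/-- Finiteness of the cube family (field `fin1`), registered for the sums `Σ_{P_{k+1}}`, `Σ_{Q_{k+1}}`. [folklore] -/
instance Sect3Data.instFintypeCube1 (D : Sect3Data P G k) : Fintype D.Cube1 := D.fin1

/-- Decidable equality of cubes (field `dec1`), for the relative complements. [folklore] -/
instance Sect3Data.instDecEqCube1 (D : Sect3Data P G k) : DecidableEq D.Cube1 := D.dec1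

/-! ## §1. (3.2): the background-field decomposition of unity -/

/-- `χ_{k+1}(X)(V_{k+1}) = Π_{□′⊂X} χ({sup_{p⊂□′^∼}|U_{k+1,□′}(∂p) − 1| < ε_{k+1}(L⁻¹η)²})` of (3.2) p. 265, the threshold
`ε_{k+1}(L⁻¹η)² = ε_{k+1}·(L^{−(k+1)})²` (`Setup.Params.eta`). [cite: Balaban1988Convergent, (3.2) p.265] -/
def chiNext (D : Sect3Data P G k) (εk1 : ℝ) (X : Finset D.Cube1) : Density P (k+1) G :=
  fun V => ∏ c ∈ X, chiSmall (D.plaqT c) (εk1 * (P.eta (k+1)) ^ 2) (D.UkLoc c V)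

/-- `χᶜ_{k+1}(X)(V_{k+1}) = Π_{□′⊂X} χ({sup … ≧ ε_{k+1}(L⁻¹η)²})` of (3.2) p. 265. [cite: Balaban1988Convergent, (3.2) p.265] -/
def chiNextc (D : Sect3Data P G k) (εk1 : ℝ) (X : Finset D.Cube1) : Density P (k+1) G :=
  fun V => ∏ c ∈ X, (1 - chiSmall (D.plaqT c) (εk1 * (P.eta (k+1)) ^ 2) (D.UkLoc c V))

/-- **(3.2)** p. 265: `1 = Σ_{P_{k+1}} χ_{k+1}(Pᶜ_{k+1}) χᶜ_{k+1}(P_{k+1})`, the sum over the unions `P_{k+1}` of cubes of the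
family `cubes` (the L²M₂R_{k+1}-cubes of `(Z′^{∼4}_k)ᶜ`), `Pᶜ_{k+1} = cubes ∖ P_{k+1}`. PROVED. [cite: Balaban1988Convergent, (3.2) p.265] -/
theorem eq32 (D : Sect3Data P G k) (εk1 : ℝ) (cubes : Finset D.Cube1) (V : GaugeField P (k+1) G) :
    ∑ Pk ∈ cubes.powerset, chiNext D εk1 (cubes \ Pk) V * chiNextc D εk1 Pk V = 1 := by
  unfold chiNext chiNextc
  set f : D.Cube1 → ℝ := fun c => chiSmall (D.plaqT c) (εk1 * (P.eta (k+1)) ^ 2) (D.UkLoc c V) with hf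
  calc ∑ Pk ∈ cubes.powerset, (∏ c ∈ cubes \ Pk, f c) * ∏ c ∈ Pk, (1 - f c)
      = ∑ Pk ∈ cubes.powerset, (∏ c ∈ Pk, (1 - f c)) * ∏ c ∈ cubes \ Pk, f c :=
        Finset.sum_congr rfl fun _ _ => mul_comm _ _
    _ = ∏ c ∈ cubes, ((1 - f c) + f c) := (Finset.prod_add _ _ _).symm
    _ = 1 := Finset.prod_eq_one fun c _ => by ring

/-! ## §2. (3.4) and (3.3): the localized k-th configuration and the approximate-fluctuation decomposition -/

/-- **(3.4)** p. 265, verbatim: *"The configuration V^{(k)}_{□′} is defined on (□′^∼)^{(k)} by V^{(k)}_{□′} = M^k(U_{k+1,□′})"*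
— the k-fold average (`Setup.Averaging.iter`) of the localized background (2.16). [cite: Balaban1988Convergent, (3.4) p.265] -/
def Vbox (D : Sect3Data P G k) (av : ∀ j, Averaging P j G) (c : D.Cube1) (V : GaugeField P (k+1) G) :
    GaugeField P k G :=
  Averaging.iter av k (D.UkLoc c V)

/-- The small approximate-fluctuation condition of (3.3) for one cube: `sup_{b∈(□′^{∼2})^{(k)*}}|V_k(b)(V^{(k)}_{□′}(b))⁻¹ − 1|
< 2δ_k`, typed as `∀ b ∈ bondsStar □′, |V_k(b)(V^{(k)}_{□′}(b))⁻¹ − 1| < 2δ_k` (`dist1 = |· − 1|`).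
[cite: Balaban1988Convergent, (3.3) p.265] -/
def SmallApproxFluct (D : Sect3Data P G k) (av : ∀ j, Averaging P j G) (twoδ : ℝ) (Vk : GaugeField P k G)
    (V : GaugeField P (k+1) G) (c : D.Cube1) : Prop :=
  ∀ b ∈ D.bondsStar c, dist1 (Vk b * (Vbox D av c V b)⁻¹) < twoδ

open Classical in
/-- `χ′_k(X)(V_k, V_{k+1}) = Π_{□′⊂X} χ({sup_{b∈(□′^{∼2})^{(k)*}}|V_k(b)(V^{(k)}_{□′}(b))⁻¹ − 1| < 2δ_k})` of (3.3) p. 265.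
[cite: Balaban1988Convergent, (3.3) p.265] -/
def chiPrime (D : Sect3Data P G k) (av : ∀ j, Averaging P j G) (twoδ : ℝ) (X : Finset D.Cube1)
    (Vk : GaugeField P k G) (V : GaugeField P (k+1) G) : ℝ :=
  ∏ c ∈ X, if SmallApproxFluct D av twoδ Vk V c then (1 : ℝ) else 0

open Classical in
/-- `χ′ᶜ_k(X)(V_k, V_{k+1}) = Π_{□′⊂X} χ({sup … ≧ 2δ_k})` of (3.3) p. 265. [cite: Balaban1988Convergent, (3.3) p.265] -/
def chiPrimec (D : Sect3Data P G k) (av : ∀ j, Averaging P j G) (twoδ : ℝ) (X : Finset D.Cube1)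
    (Vk : GaugeField P k G) (V : GaugeField P (k+1) G) : ℝ :=
  ∏ c ∈ X, if SmallApproxFluct D av twoδ Vk V c then (0 : ℝ) else 1

/-- **(3.3)** p. 265: `1 = Σ_{Q_{k+1}} χ′_k(Qᶜ_{k+1}) χ′ᶜ_k(Q_{k+1})`, the sum over the unions `Q_{k+1}` of cubes of
`(B^{k+1}(P¹_{k+1}))^{∼−1}` (= the family `inB P_{k+1}`), "the complement is relative to the domain (B^{k+1}(P¹_{k+1}))^{∼−1}".
PROVED. [cite: Balaban1988Convergent, (3.3) p.265] -/
theorem eq33 (D : Sect3Data P G k) (av : ∀ j, Averaging P j G) (twoδ : ℝ) (Pk : Finset D.Cube1)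
    (Vk : GaugeField P k G) (V : GaugeField P (k+1) G) :
    ∑ Qk ∈ (D.inB Pk).powerset,
      chiPrime D av twoδ (D.inB Pk \ Qk) Vk V * chiPrimec D av twoδ Qk Vk V = 1 := by
  classical
  unfold chiPrime chiPrimec
  set f : D.Cube1 → ℝ := fun c => if SmallApproxFluct D av twoδ Vk V c then (1 : ℝ) else 0 with hf
  set g : D.Cube1 → ℝ := fun c => if SmallApproxFluct D av twoδ Vk V c then (0 : ℝ) else 1 with hg
  have hfg : ∀ c, g c + f c = 1 := fun c => by
    by_cases h : SmallApproxFluct D av twoδ Vk V c <;> simp [hf, hg, h]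
  calc ∑ Qk ∈ (D.inB Pk).powerset, (∏ c ∈ D.inB Pk \ Qk, f c) * ∏ c ∈ Qk, g c
      = ∑ Qk ∈ (D.inB Pk).powerset, (∏ c ∈ Qk, g c) * ∏ c ∈ D.inB Pk \ Qk, f c :=
        Finset.sum_congr rfl fun _ _ => mul_comm _ _
    _ = ∏ c ∈ D.inB Pk, (g c + f c) := (Finset.prod_add _ _ _).symm
    _ = 1 := Finset.prod_eq_one fun c _ => hfg c

/-- `χ′_k(X) = 1` exactly when every cube of `X` satisfies the small approximate-fluctuation condition (it is a `0/1`
function) — the form in which (3.3)'s first factor is used on `Ω_{k+1}` (p. 266: "Thus χ_k(□) = 1 …").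
[cite: Balaban1988Convergent, (3.3) p.265] -/
theorem chiPrime_eq_one_iff (D : Sect3Data P G k) (av : ∀ j, Averaging P j G) (twoδ : ℝ) (X : Finset D.Cube1)
    (Vk : GaugeField P k G) (V : GaugeField P (k+1) G) :
    chiPrime D av twoδ X Vk V = 1 ↔ ∀ c ∈ X, SmallApproxFluct D av twoδ Vk V c := by
  classical
  unfold chiPrime
  constructor
  · intro h c hc
    by_contra hn
    have : (∏ c ∈ X, if SmallApproxFluct D av twoδ Vk V c then (1 : ℝ) else 0) = 0 :=
      Finset.prod_eq_zero hc (by simp [hn])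
    rw [this] at h; exact zero_ne_one h
  · intro h
    exact Finset.prod_eq_one fun c hc => by simp [h c hc]

/-! ## §3. (3.10), (3.11): the variational k-th field and the fluctuation field -/

/-- The constraint set of **(3.10)** p. 266: `{V_k : V̄_k = V_{k+1} on Γ_{k+1} = Ω^{(k+1)}_{k+1}, V_k(y, x) = 1 for y ∈ Γ_{k+1},
x ∈ B(y)}` — the one-step average (`Averaging.avg`) agrees with `V_{k+1}` on the bonds `Γb` of `Γ_{k+1}` and the block
axial gauge (`ContourData.holTo … = 1`, `x ≠ y`) holds on the blocks of the sites `Γs` of `Γ_{k+1}`.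
[cite: Balaban1988Convergent, (3.10) p.266] -/
def constraint310 (av : Averaging P k G) (cd : ContourData P k G) (Γb : Set (PBond P (k+1)))
    (Γs : Set (Site P (k+1))) (Vk1 : GaugeField P (k+1) G) : Set (GaugeField P k G) :=
  {Vk | (∀ c ∈ Γb, av.avg Vk c = Vk1 c) ∧
    (∀ y ∈ Γs, ∀ x : Site P k, blockOf x = y → x ≠ emb y → cd.holTo Vk y x = 1)}

/-- **(3.10)** p. 266, verbatim: *"Define the field V^{(k)} on Ω^{(k)}_{k+1} as the minimum of the functional
V_k|_{Ω^{(k)}_{k+1}} → A(U_k) for V_k : V̄_k = V_{k+1} on Γ_{k+1} = Ω^{(k+1)}_{k+1}, V_k(y, x) = 1 for y ∈ Γ_{k+1}, x ∈ B(y).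
(3.10)"* — typed reading: `V^{(k)}` minimizes the functional `F = (V_k ↦ A(U_k(V_k, …)))` (given as a function of
`V_k`, the older fields being fixed) over `constraint310`. [cite: Balaban1988Convergent, (3.10) p.266] -/
def IsV310 (F : GaugeField P k G → ℝ) (av : Averaging P k G) (cd : ContourData P k G) (Γb : Set (PBond P (k+1)))
    (Γs : Set (Site P (k+1))) (Vk1 : GaugeField P (k+1) G) (Vsup : GaugeField P k G) : Prop :=
  Vsup ∈ constraint310 av cd Γb Γs Vk1 ∧ ∀ W ∈ constraint310 av cd Γb Γs Vk1, F Vsup ≤ F W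

/-- p. 266, after (3.10), verbatim: *"This minimum is given by V^{(k)} = M^k(U_{k+1}), where the minimal configuration
U_{k+1} is determined by the sequence of domains {Ω_{k+1}, Ω_k, …}, and the corresponding sequence of fields"* — typed as
the `Prop` that the k-fold average `M^k(U_{k+1})` (`Averaging.iter av k Uk1`) is a minimizer in the sense of `IsV310`;
a CLAIM by reference to the variational results of [15], recorded, NOT proved. [cite: Balaban1988Convergent, (3.10) p.266] -/
def Claim310 (F : GaugeField P k G → ℝ) (av : ∀ j, Averaging P j G) (cd : ContourData P k G)
    (Γb : Set (PBond P (k+1))) (Γs : Set (Site P (k+1))) (Vk1 : GaugeField P (k+1) G)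
    (Uk1 : GaugeField P 0 G) : Prop :=
  IsV310 F (av k) cd Γb Γs Vk1 (Averaging.iter av k Uk1)

/-- **(3.11)** p. 266, verbatim: *"The fluctuation field V′_k is defined now by V′_k = V_k(V^{(k)})⁻¹ on B(Γ_{k+1}). (3.11)"*
— bondwise `V′_k(b) = V_k(b)·V^{(k)}(b)⁻¹` (defined on every bond; used on `B(Γ_{k+1})`). [cite: Balaban1988Convergent, (3.11) p.266] -/
def fluct311 (Vk Vsup : GaugeField P k G) : GaugeField P k G :=
  fun b => Vk b * (Vsup b)⁻¹

/-- `V′_k = 1` where `V_k = V^{(k)}` (no fluctuation). [cite: Balaban1988Convergent, (3.11) p.266] -/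
theorem fluct311_self (Vk : GaugeField P k G) : fluct311 Vk Vk = 1 := by
  funext b
  simp [fluct311]
  rfl

/-- `|V′_k(b) − 1| = |V_k(b)V^{(k)}(b)⁻¹ − 1|` is symmetric in the two fields up to inversion: `dist1 (V′) = dist1 (V′⁻¹)`
(`GaugeGroup.dist1_inv`), the form in which (3.14) compares `V_k` with `V^{(k)}`. [cite: Balaban1988Convergent, (3.11) p.266] -/
theorem dist1_fluct311_comm (Vk Vsup : GaugeField P k G) (b : PBond P k) :
    dist1 (fluct311 Vk Vsup b) = dist1 (fluct311 Vsup Vk b) := by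
  unfold fluct311
  rw [← GaugeGroup.dist1_inv (Vk b * (Vsup b)⁻¹), mul_inv_rev, inv_inv]

end Literature.MathematicalPhysics.QuantumFieldTheory.Balaban1983to89.B14.Sect3Decomp
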